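import Summits.ResolutionOfSingularities.ResolutionOfSingularities.Theses.ShadowGame
import Summits.ResolutionOfSingularities.ResolutionOfSingularities.Theorems.ValuativeTorsorToLurelFfiniteTransport
import Literature.AlgebraicGeometry.Resolution.ResolutionLU
import Literature.AlgebraicGeometry.Resolution.AffineModelObstructions
import Literature.AlgebraicGeometry.Resolution.ArithmeticalThreefoldsLocalInseparable

/-!
# Negative lemmas for crux `TorsorToLurelPerfect` (stmt-ResolutionOfSingularities-16162):
# load-bearing binders of the HYPOTHESIS `H p`

Crux `∀ p prime, H p → C p` (`H p` = LU of `α_p`-torsors `t ^ p = a` over bases regular at the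
centre, over perfect ground fields; `C p` = relative LU over perfect ground fields; cdisprove
cycle 1, §3 of `Cruxes/TorsorToLurelPerfect/Disproof.lean`). Every statement below is a
binder-mutation of `H p` written out in full (no new named `Prop`s).

* `not_torsorLUPerfect_without_frac` — `Frac k[A₀, t] = K` is load-bearing (every prime;
  `A₀ = k = 𝔽_p ⊆ K = 𝔽_p^alg`, `t = 0`): without it `H` is false and the mutated crux vacuous.
* `not_torsorLUPerfect_without_tp` — deleting `t ^ p ∈ A₀` makes `H` false because `t ∉ O` is then
  allowed (every prime; `t = X` at the place at infinity of `𝔽_p(X)`).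
* `lurelPerfect_of_torsorLU_without_baseReg` — deleting the regularity of the BASE `A₀` from `H`
  gives `C p` at once (`A₀ := R ⊔` affine model, `t := 0`): the base's regularity is what makes
  `H` weaker than `C`; the crux so mutated is a triviality.
* `lurelPerfect_of_simpleLU` — REPLACING `t ^ p ∈ A₀` by `t ∈ O` (LU of ARBITRARY simple
  extensions inside `O` of bases regular at the centre) gives a hypothesis that already implies
  `C p` by a generator induction through intermediate fields (`simple_step` = the tree's
  `torsor_step` with the `p`-th power condition deleted; `simple_steps`): the crux so mutated is
  a triviality, so ALL content of `TorsorToLurelPerfect` is the restriction to RADICAL simple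
  extensions — exactly what Temkin 2013 Thm. 1.3.2 + Frobenius over a perfect field pays for.
-/

set_option linter.dupNamespace false

open scoped Polynomial
open IsLocalRing
open Literature.AlgebraicGeometry.Resolution

namespace Summit.ResolutionOfSingularities.ResolutionOfSingularities.Theorems.TorsorToLurelPerfect.Negative

open Summit.ResolutionOfSingularities.ResolutionOfSingularities

noncomputable section

/-! ### Hypothesis binders -/

/-- Regularity at the centre of the smallest base `k[∅] = k ⊆ K` (its local ring is the field
`k`), for any valuation ring `O ⊇ k`. [folklore] -/
theorem isRegularLocalRing_centre_base {k K : Type} [Field k] [Field K] [Algebra k K]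
    (O : ValuationSubring K) (hO : ∀ c : k, algebraMap k K c ∈ O)
    (h₀ : (Algebra.adjoin k (((∅ : Finset K) : Finset K) : Set K)).toSubring ≤ O.toSubring) :
    IsRegularLocalRing (Localization.AtPrime
      (Ideal.comap (Subring.inclusion h₀) (maximalIdeal O))) := by
  refine isRegularLocalRing_centre_adjoin_empty (S := k) (Ω := K) (algebraMap k K).injective O hO
    (fun s hs => ?_) h₀
  have : s = 0 := by
    have hbot : maximalIdeal k = ⊥ :=
      (IsLocalRing.isField_iff_maximalIdeal_eq).mp (Field.toIsField k)
    simpa [hbot] using hs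
  simp [this]

/-- `k[∅] ⊆ O` whenever `k ⊆ O`. [folklore] -/
theorem adjoin_empty_le_valuationSubring {k K : Type} [Field k] [Field K] [Algebra k K]
    (O : ValuationSubring K) (hO : ∀ c : k, algebraMap k K c ∈ O) :
    (Algebra.adjoin k (((∅ : Finset K) : Finset K) : Set K)).toSubring ≤ O.toSubring := by
  intro x hx
  have hx' : x ∈ Algebra.adjoin k (((∅ : Finset K) : Finset K) : Set K) := hx
  rw [Finset.coe_empty, Algebra.adjoin_empty, Algebra.mem_bot] at hx'
  obtain ⟨c, rfl⟩ := hx'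
  exact hO c

/-- **`Frac k[A₀, t] = K` is LOAD-BEARING in `H p`**: with it deleted, torsor LU is false in every
prime characteristic (`k = 𝔽_p`, `K = 𝔽_p^alg`, `O = K`, `A₀ = k`, `t = 0`: the base is regular
at the centre, but no finitely generated `A` has `Frac A = K`); the crux with that hypothesis is
vacuously true. [folklore] -/
theorem not_torsorLUPerfect_without_frac {p : ℕ} (hp : p.Prime) :
    ¬ ∀ (k K : Type) [Field k] [CharP k p] [PerfectField k] [Field K] [Algebra k K]
      (O : ValuationSubring K) (A₀ : Subalgebra k K) (h₀ : A₀.toSubring ≤ O.toSubring) (t : K),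
      A₀.FG → t ^ p ∈ A₀ →
      IsRegularLocalRing (Localization.AtPrime
        (Ideal.comap (Subring.inclusion h₀) (maximalIdeal O))) →
      ∃ (A : Subalgebra k K) (h : A.toSubring ≤ O.toSubring), A₀ ≤ A ∧ t ∈ A ∧ A.FG ∧
        IsFractionRing A K ∧
        IsRegularLocalRing (Localization.AtPrime
          (Ideal.comap (Subring.inclusion h) (maximalIdeal O))) := by
  intro H
  haveI : Fact p.Prime := ⟨hp⟩
  have hO : ∀ c : ZMod p, algebraMap (ZMod p) (AlgebraicClosure (ZMod p)) c ∈
      (⊤ : ValuationSubring (AlgebraicClosure (ZMod p))) :=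
    fun _ => ValuationSubring.mem_top _
  have h₀ := adjoin_empty_le_valuationSubring (⊤ : ValuationSubring (AlgebraicClosure (ZMod p))) hO
  obtain ⟨A, -, -, -, hfg, hfr, -⟩ := H (ZMod p) (AlgebraicClosure (ZMod p)) ⊤ _ h₀ 0 ⟨∅, rfl⟩
    (by rw [zero_pow hp.ne_zero]; exact Subalgebra.zero_mem _)
    (isRegularLocalRing_centre_base ⊤ hO h₀)
  exact not_exists_fg_isFractionRing_algebraicClosure p ⟨A, hfg, hfr⟩

/-- **Deleting `t ^ p ∈ A₀` from `H p` makes it FALSE because `t ∉ O` is then allowed** (every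
prime: `k = 𝔽_p`, `K = 𝔽_p(X)`, `O` the place at infinity, `A₀ = k`, `t = X`); the radical
condition is what carries `t ∈ O`. The informative mutation is `lurelPerfect_of_simpleLU`.
[folklore] -/
theorem not_torsorLUPerfect_without_tp {p : ℕ} (hp : p.Prime) :
    ¬ ∀ (k K : Type) [Field k] [CharP k p] [PerfectField k] [Field K] [Algebra k K]
      (O : ValuationSubring K) (A₀ : Subalgebra k K) (h₀ : A₀.toSubring ≤ O.toSubring) (t : K),
      A₀.FG → IsFractionRing (Algebra.adjoin k (insert t (A₀ : Set K))) K →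
      IsRegularLocalRing (Localization.AtPrime
        (Ideal.comap (Subring.inclusion h₀) (maximalIdeal O))) →
      ∃ (A : Subalgebra k K) (h : A.toSubring ≤ O.toSubring), A₀ ≤ A ∧ t ∈ A ∧ A.FG ∧
        IsFractionRing A K ∧
        IsRegularLocalRing (Localization.AtPrime
          (Ideal.comap (Subring.inclusion h) (maximalIdeal O))) := by
  intro H
  classical
  haveI : Fact p.Prime := ⟨hp⟩
  set K := RatFunc (ZMod p)
  set O : ValuationSubring K := (RatFunc.inftyValuation (ZMod p)).valuationSubring with hOdef
  have hO : ∀ c : ZMod p, algebraMap (ZMod p) K c ∈ O := by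
    intro c
    rw [hOdef, Valuation.mem_valuationSubring_iff]
    by_cases hc : c = 0
    · simp [hc]
    · rw [RatFunc.algebraMap_eq_C, RatFunc.inftyValuation.C _ hc]
  have h₀ := adjoin_empty_le_valuationSubring O hO
  have hfrac : IsFractionRing
      (Algebra.adjoin (ZMod p) (insert (RatFunc.X : K)
        ((Algebra.adjoin (ZMod p) (((∅ : Finset K) : Finset K) : Set K) : Subalgebra (ZMod p) K) :
          Set K))) K := by
    refine IsFractionRing.of_field _ K fun z => ?_
    have hmem : ∀ f : Polynomial (ZMod p), algebraMap (Polynomial (ZMod p)) K f ∈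
        Algebra.adjoin (ZMod p) (insert (RatFunc.X : K)
          ((Algebra.adjoin (ZMod p) (((∅ : Finset K) : Finset K) : Set K) :
            Subalgebra (ZMod p) K) : Set K)) := by
      intro f
      rw [← RatFunc.aeval_X_left_eq_algebraMap]
      exact Algebra.adjoin_mono (Set.singleton_subset_iff.mpr (Set.mem_insert _ _))
        (Polynomial.aeval_mem_adjoin_singleton (ZMod p) _)
    refine ⟨⟨_, hmem z.num⟩, ⟨_, hmem z.denom⟩, ?_⟩
    change z = algebraMap (Polynomial (ZMod p)) K z.num / algebraMap (Polynomial (ZMod p)) K z.denom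
    rw [RatFunc.num_div_denom]
  obtain ⟨A, hA, -, hXA, -, -, -⟩ := H (ZMod p) K O _ h₀ RatFunc.X ⟨∅, rfl⟩ hfrac
    (isRegularLocalRing_centre_base O hO h₀)
  have hX : (RatFunc.X : K) ∈ O := hA (A.mem_toSubring.mpr hXA)
  rw [hOdef, Valuation.mem_valuationSubring_iff, RatFunc.inftyValuation.X, ← WithZero.exp_zero,
    WithZero.exp_le_exp] at hX
  exact absurd hX (by decide)

/-- **Deleting the regularity of the BASE `A₀` from `H p` gives `C p` at once**
(`A₀ := R ⊔` affine model of `K` inside `O`, `t := 0`): the base's regularity is exactly what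
makes `H` weaker than `C`, and the crux with that hypothesis is a triviality. [folklore] -/
theorem lurelPerfect_of_torsorLU_without_baseReg {p : ℕ} (hp : p.Prime)
    (h : ∀ (k K : Type) [Field k] [CharP k p] [PerfectField k] [Field K] [Algebra k K]
      (O : ValuationSubring K) (A₀ : Subalgebra k K) (_ : A₀.toSubring ≤ O.toSubring) (t : K),
      A₀.FG → t ^ p ∈ A₀ → IsFractionRing (Algebra.adjoin k (insert t (A₀ : Set K))) K →
      ∃ (A : Subalgebra k K) (h : A.toSubring ≤ O.toSubring), A₀ ≤ A ∧ t ∈ A ∧ A.FG ∧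
        IsFractionRing A K ∧
        IsRegularLocalRing (Localization.AtPrime
          (Ideal.comap (Subring.inclusion h) (maximalIdeal O)))) :
    ∀ (k K : Type) [Field k] [CharP k p] [PerfectField k] [Field K] [Algebra k K],
      (⊤ : IntermediateField k K).FG → ∀ O : ValuationSubring K, (∀ c : k, algebraMap k K c ∈ O) →
      ∀ R : Subalgebra k K, R.FG → R.toSubring ≤ O.toSubring →
      ∃ (A : Subalgebra k K) (h : A.toSubring ≤ O.toSubring), R ≤ A ∧ A.FG ∧ IsFractionRing A K ∧
        IsRegularLocalRing (Localization.AtPrime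
          (Ideal.comap (Subring.inclusion h) (maximalIdeal O))) := by
  intro k K _ _ _ _ _ hKfg O hO R hRfg hRO
  obtain ⟨A₁, hA₁O, hA₁fg, hA₁fr⟩ := exists_affineModel k K hKfg O hO
  let Oalg : Subalgebra k K := { O.toSubring with algebraMap_mem' := hO }
  have hR'O : (R ⊔ A₁).toSubring ≤ O.toSubring := by
    change R ⊔ A₁ ≤ Oalg
    exact sup_le (fun x hx => hRO hx) (fun x hx => hA₁O hx)
  have h0 : (0 : K) ^ p ∈ R ⊔ A₁ := by
    rw [zero_pow hp.ne_zero]; exact Subalgebra.zero_mem _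
  have hle : R ⊔ A₁ ≤ Algebra.adjoin k (insert (0 : K) ((R ⊔ A₁ : Subalgebra k K) : Set K)) :=
    fun x hx => Algebra.subset_adjoin (Set.mem_insert_of_mem _ hx)
  have hfr : IsFractionRing
      (Algebra.adjoin k (insert (0 : K) ((R ⊔ A₁ : Subalgebra k K) : Set K))) K :=
    isFractionRing_of_le (le_sup_right.trans hle) hA₁fr
  obtain ⟨A, hA, hle', -, hAfg, hAfr, hreg⟩ := h k K O (R ⊔ A₁) hR'O 0 (hRfg.sup hA₁fg) h0 hfr
  exact ⟨A, hA, le_sup_left.trans hle', hAfg, hAfr, hreg⟩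

/-! ### Replacing `t ^ p ∈ A₀` by `t ∈ O`: the crux becomes a triviality -/

section simpleClimb

variable {p : ℕ}
  (hS : ∀ (k K : Type) [Field k] [CharP k p] [PerfectField k] [Field K] [Algebra k K]
    (O : ValuationSubring K) (A₀ : Subalgebra k K) (h₀ : A₀.toSubring ≤ O.toSubring) (t : K),
    A₀.FG → t ∈ O → IsFractionRing (Algebra.adjoin k (insert t (A₀ : Set K))) K →
    IsRegularLocalRing (Localization.AtPrime
      (Ideal.comap (Subring.inclusion h₀) (maximalIdeal O))) →
    ∃ (A : Subalgebra k K) (h : A.toSubring ≤ O.toSubring), A₀ ≤ A ∧ t ∈ A ∧ A.FG ∧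
      IsFractionRing A K ∧
      IsRegularLocalRing (Localization.AtPrime (Ideal.comap (Subring.inclusion h) (maximalIdeal O))))
  {k K : Type} [Field k] [CharP k p] [PerfectField k] [Field K] [Algebra k K]
  (O : ValuationSubring K)

include hS

/-- **One simple step inside `K`** (the tree's `torsor_step` with `t ^ p ∈ A₀` replaced by
`t ∈ O`; `hS` is LU of arbitrary simple extensions inside `O` of regular-centred bases, over
perfect ground fields): if `A₀ ⊆ O` is finitely generated and regular at the centre and `t ∈ O`,
then — `hS` applied to the subfield `E = k(A₀, t)` made a type, the valuation ring `O ∩ E` and the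
copy of `A₀` in `E` — there is a finitely generated `A ⊇ A₀ ∪ {t}` inside `O`, regular at the
centre. [folklore] -/
theorem simple_step (A₀ : Subalgebra k K) (h₀ : A₀.toSubring ≤ O.toSubring) (hfg : A₀.FG)
    (hreg : IsRegularLocalRing (Localization.AtPrime
      (Ideal.comap (Subring.inclusion h₀) (maximalIdeal O))))
    (t : K) (htO : t ∈ O) :
    ∃ (A : Subalgebra k K) (h : A.toSubring ≤ O.toSubring), A₀ ≤ A ∧ t ∈ A ∧ A.FG ∧
      IsRegularLocalRing (Localization.AtPrime
        (Ideal.comap (Subring.inclusion h) (maximalIdeal O))) := by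
  classical
  set E : IntermediateField k K := IntermediateField.adjoin k (insert t (A₀ : Set K)) with hE
  let ι : E →+* K := (E.val : E →ₐ[k] K)
  let O' : ValuationSubring E := O.comap ι
  let A₀' : Subalgebra k E := A₀.comap E.val
  have htE : t ∈ E := IntermediateField.subset_adjoin k _ (Set.mem_insert t _)
  have hA₀E : A₀ ≤ E.val.range := by
    intro x hx
    exact ⟨⟨x, IntermediateField.subset_adjoin k _ (Set.mem_insert_of_mem t hx)⟩, rfl⟩
  have hmap : A₀'.map E.val = A₀ := Subalgebra.map_comap_eq_self hA₀E
  let t' : E := ⟨t, htE⟩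
  have h₀' : A₀'.toSubring ≤ O'.toSubring := by
    intro x hx
    change ι x ∈ O
    exact h₀ (show (x : K) ∈ A₀ from hx)
  have hfg' : A₀'.FG :=
    Subalgebra.fg_of_fg_map _ E.val (fun _ _ h => Subtype.ext h) (by rw [hmap]; exact hfg)
  have htO' : t' ∈ O' := by
    change ι t' ∈ O
    exact htO
  have hadj : (Algebra.adjoin k (insert t' (A₀' : Set E))).map E.val =
      Algebra.adjoin k (insert t (A₀ : Set K)) := by
    have himg : (E.val : E → K) '' (A₀' : Set E) = (A₀ : Set K) := by
      rw [← Subalgebra.coe_map, hmap]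
    rw [AlgHom.map_adjoin, Set.image_insert_eq, himg]
    rfl
  have hfrac' : IsFractionRing (Algebra.adjoin k (insert t' (A₀' : Set E))) E := by
    refine IsFractionRing.of_field _ E fun z => ?_
    have hz : (z : K) ∈ IntermediateField.adjoin k (insert t (A₀ : Set K)) := z.2
    obtain ⟨r, hr, s, hs, hrs⟩ := IntermediateField.mem_adjoin_iff_div.mp hz
    rw [← hadj] at hr hs
    obtain ⟨r', hr', rfl⟩ := Subalgebra.mem_map.mp hr
    obtain ⟨s', hs', rfl⟩ := Subalgebra.mem_map.mp hs
    refine ⟨⟨r', hr'⟩, ⟨s', hs'⟩, Subtype.ext ?_⟩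
    simpa using hrs
  have hreg' : IsRegularLocalRing (Localization.AtPrime
      (Ideal.comap (Subring.inclusion h₀') (maximalIdeal O'))) := by
    have hB : A₀'.toSubring.map ι = A₀.toSubring := by
      ext x
      constructor
      · rintro ⟨y, hy, rfl⟩
        exact hy
      · intro hx
        obtain ⟨y, rfl⟩ := hA₀E hx
        exact ⟨y, hx, rfl⟩
    exact (Theorems.isRegularLocalRing_centre_map_iff ι O A₀'.toSubring A₀.toSubring hB h₀' h₀).mpr
      hreg
  -- apply `hS` inside `E` (ground field still the perfect `k`)
  obtain ⟨A', h', hle', ht', hfgA', -, hregA'⟩ := hS k E O' A₀' h₀' t' hfg' htO' hfrac' hreg'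
  -- push the chart forward to `K`
  let A : Subalgebra k K := A'.map E.val
  have h : A.toSubring ≤ O.toSubring := by
    rintro _ ⟨y, hy, rfl⟩
    exact h' hy
  refine ⟨A, h, ?_, ⟨t', ht', rfl⟩, hfgA'.map _, ?_⟩
  · rw [← hmap]
    exact Subalgebra.map_mono hle'
  · have hB : A'.toSubring.map ι = A.toSubring := by
      ext x
      constructor
      · rintro ⟨y, hy, rfl⟩
        exact ⟨y, hy, rfl⟩
      · rintro ⟨y, hy, rfl⟩
        exact ⟨y, hy, rfl⟩
    exact (Theorems.isRegularLocalRing_centre_map_iff ι O A'.toSubring A.toSubring hB h' h).mp hregA'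

/-- **Finitely many simple steps.** [folklore] -/
theorem simple_steps (G : Finset K) :
    ∀ (A₀ : Subalgebra k K) (h₀ : A₀.toSubring ≤ O.toSubring), A₀.FG →
      IsRegularLocalRing (Localization.AtPrime
        (Ideal.comap (Subring.inclusion h₀) (maximalIdeal O))) →
      (∀ g ∈ G, g ∈ O) →
      ∃ (A : Subalgebra k K) (h : A.toSubring ≤ O.toSubring), A₀ ≤ A ∧ (∀ g ∈ G, g ∈ A) ∧ A.FG ∧
        IsRegularLocalRing (Localization.AtPrime
          (Ideal.comap (Subring.inclusion h) (maximalIdeal O))) := by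
  classical
  induction G using Finset.induction_on with
  | empty =>
    intro A₀ h₀ hfg hreg _
    exact ⟨A₀, h₀, le_rfl, fun g hg => absurd hg (Finset.notMem_empty g), hfg, hreg⟩
  | insert g G hgG ih =>
    intro A₀ h₀ hfg hreg hGO
    obtain ⟨A₁, h₁, hle₁, hG₁, hfg₁, hreg₁⟩ := ih A₀ h₀ hfg hreg
      (fun x hx => hGO x (Finset.mem_insert_of_mem hx))
    obtain ⟨A, h, hle, hgA, hfgA, hregA⟩ :=
      simple_step hS O A₁ h₁ hfg₁ hreg₁ g (hGO g (Finset.mem_insert_self g G))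
    refine ⟨A, h, hle₁.trans hle, fun x hx => ?_, hfgA, hregA⟩
    rcases Finset.mem_insert.mp hx with rfl | hx
    · exact hgA
    · exact hle (hG₁ x hx)

/-- **`SimpleLU p → C p`: with `t ^ p ∈ A₀` replaced by `t ∈ O`, the crux is a TRIVIALITY** —
climb from the base `k[∅] = k` (regular at the centre) through the generators of `R` and of an
affine model of `K` inside `O`; no Temkin, no Frobenius, no radical tower. So ALL content of
`TorsorToLurelPerfect` is the restriction of its hypothesis to RADICAL simple extensions.
[folklore] -/
theorem lurelPerfect_of_simpleLU (hKfg : (⊤ : IntermediateField k K).FG)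
    (hO : ∀ c : k, algebraMap k K c ∈ O) (R : Subalgebra k K) (hRfg : R.FG)
    (hRO : R.toSubring ≤ O.toSubring) :
    ∃ (A : Subalgebra k K) (h : A.toSubring ≤ O.toSubring), R ≤ A ∧ A.FG ∧ IsFractionRing A K ∧
      IsRegularLocalRing (Localization.AtPrime
        (Ideal.comap (Subring.inclusion h) (maximalIdeal O))) := by
  classical
  obtain ⟨A₁, hA₁O, hA₁fg, hA₁fr⟩ := exists_affineModel k K hKfg O hO
  obtain ⟨sR, hsR⟩ := hRfg
  obtain ⟨s₁, hs₁⟩ := hA₁fg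
  have h₀ := adjoin_empty_le_valuationSubring O hO
  have hGO : ∀ g ∈ sR ∪ s₁, g ∈ O := by
    intro g hg
    rcases Finset.mem_union.mp hg with hg | hg
    · exact hRO (hsR ▸ Algebra.subset_adjoin hg : g ∈ R)
    · exact hA₁O (hs₁ ▸ Algebra.subset_adjoin hg : g ∈ A₁)
  obtain ⟨A, h, -, hG, hAfg, hreg⟩ := simple_steps hS O (sR ∪ s₁) _ h₀ ⟨∅, rfl⟩
    (isRegularLocalRing_centre_base O hO h₀) hGO
  have hRA : R ≤ A := by
    rw [← hsR]
    exact Algebra.adjoin_le fun g hg => hG g (Finset.mem_union_left _ hg)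
  have hA₁A : A₁ ≤ A := by
    rw [← hs₁]
    exact Algebra.adjoin_le fun g hg => hG g (Finset.mem_union_right _ hg)
  exact ⟨A, h, hRA, hAfg, isFractionRing_of_le hA₁A hA₁fr, hreg⟩

end simpleClimb

end

end Summit.ResolutionOfSingularities.ResolutionOfSingularities.Theorems.TorsorToLurelPerfect.Negative
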